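import Summits.AnomalousDissipation.AnomalousDissipation.Theorems.ScalarAnomalySteadySourceFormal.Negative.WienNoGo

/-!
# Negative knowledge for the crux `ScalarAnomalySteadySourceFormal` (stmt-AnomalousDissipation-0448), X-h:
# NO-GO in plain Fourier-decay form — stirring with uniform decay `‖𝓕v_j(t)(q)‖ ≤ B (1+|q|_∞)^{-σ}`, `σ > 4`

Certified copy of §12.8 of the cdisprove work file.  `Negative.WienNoGo.wiener_not_anomalous` restated
without the `wienField` vocabulary (`fourierDecay_not_anomalous`): velocities `v_j : ℝ → 𝕋² → ℝ²`
continuous in `x` for each `t` and in `t` for each `x`, spectrally divergence-free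
(`∑ᵢ qᵢ 𝓕(v_j)ᵢ(t)(q) = 0`), with the UNIFORM FOURIER DECAY `‖𝓕v_j(t)(q)‖ ≤ B (1 + |q|_∞)^{-σ}` for
some `σ > 4` and all `j, t, q` — e.g. any family bounded in `C_t C^{6}_x`, or in `C_t H^{σ+1+}_x`,
uniformly in `j` — cannot witness the crux: bounded variance excludes a dissipation floor, for
arbitrary `L²` data and weak solutions.  Bridging lemmas: the vector of component coefficients
`vecCoeff`, its conjugate symmetry for real fields, pointwise Fourier synthesis
(`hasSum_mFourier_series_apply_of_summable`) giving `v_j(t) = wienField (vecCoeff v_j t)`,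
continuity in `t` by dominated convergence, and the lattice summability
`∑_{q∈ℤ²} (1+|q|_∞)^{-τ} < ∞` for `τ > 2` (product bound through `ℤ × ℤ`).

Supports stmt-AnomalousDissipation-0448.
-/

set_option linter.dupNamespace false

noncomputable section

open scoped BigOperators Topology ENNReal NNReal InnerProductSpace ContDiff
open Filter Set Function MeasureTheory UnitAddTorus Complex

namespace Summit.AnomalousDissipation.AnomalousDissipation.Theorems.ScalarAnomalySteadySourceFormal.Negative

open Literature.Analysis
open Literature.Analysis.FunctionSpaces Literature.Analysis.FunctionSpaces.Torus
open Literature.Analysis.FluidPDE Literature.Analysis.FluidPDE.Torus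

/-- The frequency lattice `ℤ²` (local notation). -/
local notation "ℤ²" => Fin 2 → ℤ

section Lattice

/-- `∑_{n∈ℤ} (1+|n|)^{-p} < ∞` for `p > 1`. [folklore] -/
theorem summable_one_add_abs_int_rpow {p : ℝ} (hp : 1 < p) : Summable fun n : ℤ => (1 + |(n : ℝ)|) ^ (-p) := by
  have h1 := Real.summable_abs_int_rpow hp
  have h2 : Summable fun n : ℤ => if n = 0 then (1 : ℝ) else 0 := summable_of_ne_finset_zero (s := {0}) (by
    intro n hn; rw [Finset.mem_singleton] at hn; simp [hn])
  refine Summable.of_nonneg_of_le (fun n => by positivity) (fun n => ?_) (h1.add h2)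
  by_cases hn : n = 0
  · subst hn; simp; exact Real.rpow_nonneg le_rfl _
  · rw [if_neg hn, add_zero]
    have hn' : (0 : ℝ) < |(n : ℝ)| := by rw [abs_pos]; exact_mod_cast hn
    exact Real.rpow_le_rpow_of_nonpos hn' (by linarith [abs_nonneg (n : ℝ)]) (by linarith)

/-- `(1+|q|_∞)^{-τ} ≤ (1+|q₀|)^{-τ/2} (1+|q₁|)^{-τ/2}` for `τ ≥ 0`. [folklore] -/
theorem rpow_qrad_le_prod (q : ℤ²) {τ : ℝ} (hτ : 0 ≤ τ) :
    (1 + (qrad q : ℝ)) ^ (-τ) ≤ (1 + |(q 0 : ℝ)|) ^ (-(τ / 2)) * (1 + |(q 1 : ℝ)|) ^ (-(τ / 2)) := by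
  have h0 : |(q 0 : ℝ)| ≤ qrad q := by
    have := abs_apply_zero_le_qrad q
    have e : ((qrad q : ℤ) : ℝ) = (qrad q : ℝ) := by simp
    rw [← Int.cast_abs, ← e]; exact_mod_cast this
  have h1 : |(q 1 : ℝ)| ≤ qrad q := by
    have := abs_apply_one_le_qrad q
    have e : ((qrad q : ℤ) : ℝ) = (qrad q : ℝ) := by simp
    rw [← Int.cast_abs, ← e]; exact_mod_cast this
  have ha : 0 < 1 + |(q 0 : ℝ)| := by positivity
  have hb : 0 < 1 + |(q 1 : ℝ)| := by positivity
  have hc : 0 < 1 + (qrad q : ℝ) := by positivity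
  -- `(1+r)^{-τ} = ((1+r)^{-τ/2})² ≤ (1+|q₀|)^{-τ/2} (1+|q₁|)^{-τ/2}`
  have e : (1 + (qrad q : ℝ)) ^ (-τ) = (1 + (qrad q : ℝ)) ^ (-(τ / 2)) * (1 + (qrad q : ℝ)) ^ (-(τ / 2)) := by
    rw [← Real.rpow_add hc]; ring_nf
  rw [e]
  have hτ2 : -(τ / 2) ≤ 0 := by linarith
  exact mul_le_mul (Real.rpow_le_rpow_of_nonpos ha (by linarith) hτ2)
    (Real.rpow_le_rpow_of_nonpos hb (by linarith) hτ2) (Real.rpow_nonneg hc.le _) (Real.rpow_nonneg ha.le _)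

/-- **Lattice summability**: `∑_{q∈ℤ²} (1+|q|_∞)^{-τ} < ∞` for `τ > 2`. [folklore] -/
theorem summable_rpow_qrad {τ : ℝ} (hτ : 2 < τ) : Summable fun q : ℤ² => (1 + (qrad q : ℝ)) ^ (-τ) := by
  have hp : 1 < τ / 2 := by linarith
  have h1 := summable_one_add_abs_int_rpow hp
  have hprod : Summable fun x : ℤ × ℤ => (1 + |(x.1 : ℝ)|) ^ (-(τ / 2)) * (1 + |(x.2 : ℝ)|) ^ (-(τ / 2)) :=
    h1.mul_of_nonneg h1 (fun n => by positivity) (fun n => by positivity)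
  have h2 : Summable fun q : ℤ² => (1 + |(q 0 : ℝ)|) ^ (-(τ / 2)) * (1 + |(q 1 : ℝ)|) ^ (-(τ / 2)) := by
    have := (finTwoArrowEquiv ℤ).summable_iff.2 hprod
    exact this.congr fun q => by simp [Function.comp, finTwoArrowEquiv, piFinTwoEquiv]
  exact Summable.of_nonneg_of_le (fun q => Real.rpow_nonneg (by positivity) _) (fun q => rpow_qrad_le_prod q (by linarith)) h2

/-- Moments: `r^k (1+r)^{-σ} ≤ (1+r)^{-(σ-k)}`. [folklore] -/
theorem qrad_pow_mul_rpow_le (q : ℤ²) (k : ℕ) (σ : ℝ) :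
    (qrad q : ℝ) ^ k * (1 + (qrad q : ℝ)) ^ (-σ) ≤ (1 + (qrad q : ℝ)) ^ (-(σ - k)) := by
  have hc : 0 < 1 + (qrad q : ℝ) := by positivity
  have hr : (0 : ℝ) ≤ qrad q := (qrad q).cast_nonneg
  have e : (1 + (qrad q : ℝ)) ^ (-(σ - k)) = (1 + (qrad q : ℝ)) ^ (k : ℝ) * (1 + (qrad q : ℝ)) ^ (-σ) := by
    rw [← Real.rpow_add hc]; ring_nf
  rw [e, Real.rpow_natCast]
  exact mul_le_mul_of_nonneg_right (pow_le_pow_left₀ hr (by linarith) k) (Real.rpow_nonneg hc.le _)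

end Lattice

section VecCoeff

variable {v : ℝ → UnitAddTorus (Fin 2) → EuclideanSpace ℝ (Fin 2)}

/-- The vector of component Fourier coefficients of a real velocity slice. [folklore] -/
def vecCoeff (v : ℝ → UnitAddTorus (Fin 2) → EuclideanSpace ℝ (Fin 2)) (s : ℝ) (q : ℤ²) : EuclideanSpace ℂ (Fin 2) :=
  WithLp.toLp 2 fun i => mFourierCoeff (fun x => ((v s x i : ℝ) : ℂ)) q

/-- Components. [folklore] -/
theorem vecCoeff_apply (s : ℝ) (q : ℤ²) (i : Fin 2) : vecCoeff v s q i = mFourierCoeff (fun x => ((v s x i : ℝ) : ℂ)) q := rfl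

/-- `conj 𝓕f(q) = 𝓕f(-q)` for real `f`. [folklore] -/
theorem conj_mFourierCoeff_real (f : UnitAddTorus (Fin 2) → ℝ) (q : ℤ²) :
    (starRingEnd ℂ) (mFourierCoeff (fun x => ((f x : ℝ) : ℂ)) q) = mFourierCoeff (fun x => ((f x : ℝ) : ℂ)) (-q) := by
  rw [FunctionSpaces.Torus.mFourierCoeff_eq_integral_volume, FunctionSpaces.Torus.mFourierCoeff_eq_integral_volume, ← integral_conj]
  refine integral_congr_ae (Eventually.of_forall fun x => ?_)
  simp only [smul_eq_mul, map_mul, Complex.conj_ofReal, neg_neg]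
  rw [← mFourier_neg, neg_neg]

/-- **Conjugate symmetry** of the coefficients of a real field. [folklore] -/
theorem vecCoeff_neg (s : ℝ) (q : ℤ²) : vecCoeff v s (-q) = EuclideanSpace.conjVec (vecCoeff v s q) := by
  ext i
  rw [EuclideanSpace.conjVec_apply, vecCoeff_apply, vecCoeff_apply, conj_mFourierCoeff_real]

/-- **Fourier synthesis**: a continuous slice with summable coefficients is the Wiener field of its
coefficients. [folklore] -/
theorem eq_wienField_vecCoeff {a : ℤ² → ℝ} (hvx : ∀ s, Continuous (v s)) (hCa : ∀ s q, ‖vecCoeff v s q‖ ≤ a q)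
    (hsa : Summable a) (s : ℝ) : v s = wienField (vecCoeff v s) := by
  funext x
  ext i
  rw [wienField_apply, wienComp]
  -- the component as a continuous map with summable coefficients
  set F : C(UnitAddTorus (Fin 2), ℂ) := ⟨fun x => ((v s x i : ℝ) : ℂ),
    Complex.continuous_ofReal.comp ((EuclideanSpace.proj i).continuous.comp (hvx s))⟩ with hF
  have hcoef : ∀ q, mFourierCoeff F q = vecCoeff v s q i := fun q => rfl
  have hsumF : Summable (mFourierCoeff F) := by
    refine Summable.of_norm_bounded (g := a) hsa fun q => ?_
    rw [hcoef]; exact (PiLp.norm_apply_le (vecCoeff v s q) i).trans (hCa s q)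
  have hsyn := hasSum_mFourier_series_apply_of_summable hsumF x
  have e : (∑' q, mFourier q x * vecCoeff v s q i) = F x := by
    rw [← hsyn.tsum_eq]
    exact tsum_congr fun q => by rw [hcoef, smul_eq_mul, mul_comm]
  rw [e]
  simp [hF]

/-- Sup bound of a slice from the coefficient majorant. [folklore] -/
theorem abs_apply_le_tsum {a : ℤ² → ℝ} (hvx : ∀ s, Continuous (v s)) (hCa : ∀ s q, ‖vecCoeff v s q‖ ≤ a q)
    (hsa : Summable a) (s : ℝ) (x : UnitAddTorus (Fin 2)) (i : Fin 2) : |v s x i| ≤ ∑' q, a q := by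
  have h := abs_wienField_apply_le (C := vecCoeff v s) (summable_norm_of_majorant hCa hsa s) x i
  rw [← eq_wienField_vecCoeff hvx hCa hsa s] at h
  exact h.trans (Summable.tsum_le_tsum (hCa s) (summable_norm_of_majorant hCa hsa s) hsa)

/-- **Continuity of the coefficient paths** (dominated convergence). [folklore] -/
theorem continuous_vecCoeff {a : ℤ² → ℝ} (hvx : ∀ s, Continuous (v s)) (hvs : ∀ x, Continuous fun s => v s x)
    (hCa : ∀ s q, ‖vecCoeff v s q‖ ≤ a q) (hsa : Summable a) (q : ℤ²) : Continuous fun s => vecCoeff v s q := by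
  unfold vecCoeff
  refine (PiLp.continuous_toLp 2 _).comp (continuous_pi fun i => ?_)
  simp_rw [FunctionSpaces.Torus.mFourierCoeff_eq_integral_volume]
  refine continuous_of_dominated (bound := fun _ => ∑' q, a q) (fun s => ?_) (fun s => Eventually.of_forall fun x => ?_)
    (integrable_const _) (Eventually.of_forall fun x => ?_)
  · exact ((mFourier (-q)).continuous.smul (Complex.continuous_ofReal.comp
      ((EuclideanSpace.proj i).continuous.comp (hvx s)))).aestronglyMeasurable
  · rw [norm_smul, Complex.norm_real, Real.norm_eq_abs]
    calc ‖mFourier (-q) x‖ * |v s x i| ≤ 1 * ∑' q, a q :=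
          mul_le_mul (((mFourier (-q)).norm_coe_le_norm x).trans_eq mFourier_norm) (abs_apply_le_tsum hvx hCa hsa s x i)
            (abs_nonneg _) zero_le_one
      _ = ∑' q, a q := one_mul _
  · exact ((Complex.continuous_ofReal.comp ((EuclideanSpace.proj i).continuous.comp (hvs x))).const_smul
      (mFourier (-q) x)).congr fun s => rfl

end VecCoeff

section FourierDecay

variable {h : UnitAddTorus (Fin 2) → ℝ}

/-- **NO-GO in Fourier-decay form**: stirring with the uniform decay `‖𝓕v_j(t)(q)‖ ≤ B(1+|q|_∞)^{-σ}`,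
`σ > 4` (continuous in `x` and in `t`, spectrally divergence-free) cannot witness the crux. [folklore] -/
theorem fourierDecay_not_anomalous (hh : IsSmooth h) (hmean : HasZeroMean h)
    {σ B : ℝ} (hσ : 4 < σ) (hB : 0 ≤ B)
    {νs : ℕ → ℝ} (hν : ∀ j, 0 < νs j) (hν0 : Tendsto νs atTop (nhds 0))
    {vs : ℕ → ℝ → UnitAddTorus (Fin 2) → EuclideanSpace ℝ (Fin 2)}
    (hvx : ∀ j s, Continuous (vs j s)) (hvs : ∀ j x, Continuous fun s => vs j s x)
    (hdec : ∀ j s q, ‖vecCoeff (vs j) s q‖ ≤ B * (1 + (qrad q : ℝ)) ^ (-σ))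
    (hdiv : ∀ j s q, zdot q (vecCoeff (vs j) s q) = 0)
    {θ₀s : ℕ → UnitAddTorus (Fin 2) → ℝ} (hθ₀ : ∀ j, MemLp (θ₀s j) 2 volume)
    {θs : ℕ → ℝ → UnitAddTorus (Fin 2) → ℝ}
    (hweak : ∀ j, IsWeakScalarTransportForced (νs j) (vs j) (fun _ => h) (θ₀s j) (θs j))
    {E : ℝ} (hV : ∀ j, longTimeAvgSup (fun t => scalarL2Sq (θs j t)) ≤ E) :
    ¬ ∃ ε : ℝ, 0 < ε ∧ ∀ j, ε ≤ longTimeAvgSup (fun t => νs j * (eScalarGradNormSq (θs j t)).toReal) := by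
  set a : ℤ² → ℝ := fun q => B * (1 + (qrad q : ℝ)) ^ (-σ) with ha
  have hsa : Summable a := (summable_rpow_qrad (by linarith : (2 : ℝ) < σ)).mul_left B
  have hsa1 : Summable fun q => (qrad q : ℝ) * a q := by
    have hs := (summable_rpow_qrad (by linarith : (2 : ℝ) < σ - 1)).mul_left B
    refine Summable.of_nonneg_of_le (fun q => by positivity) (fun q => ?_) hs
    have h1 := qrad_pow_mul_rpow_le q 1 σ
    rw [pow_one] at h1
    calc (qrad q : ℝ) * a q = B * ((qrad q : ℝ) * (1 + (qrad q : ℝ)) ^ (-σ)) := by rw [ha]; ring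
      _ ≤ B * (1 + (qrad q : ℝ)) ^ (-(σ - (1 : ℕ))) := mul_le_mul_of_nonneg_left h1 hB
      _ = B * (1 + (qrad q : ℝ)) ^ (-(σ - 1)) := by norm_num
  have hsa2 : Summable fun q => (qrad q : ℝ) ^ 2 * a q := by
    have hs := (summable_rpow_qrad (by linarith : (2 : ℝ) < σ - 2)).mul_left B
    refine Summable.of_nonneg_of_le (fun q => by positivity) (fun q => ?_) hs
    have h1 := qrad_pow_mul_rpow_le q 2 σ
    calc (qrad q : ℝ) ^ 2 * a q = B * ((qrad q : ℝ) ^ 2 * (1 + (qrad q : ℝ)) ^ (-σ)) := by rw [ha]; ring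
      _ ≤ B * (1 + (qrad q : ℝ)) ^ (-(σ - (2 : ℕ))) := mul_le_mul_of_nonneg_left h1 hB
      _ = B * (1 + (qrad q : ℝ)) ^ (-(σ - 2)) := by norm_num
  have hCa : ∀ j s q, ‖vecCoeff (vs j) s q‖ ≤ a q := fun j s q => hdec j s q
  exact wiener_not_anomalous hh hmean hsa hsa1 hsa2 hν hν0 (Cs := fun j => vecCoeff (vs j)) hCa
    (fun j s q => vecCoeff_neg s q) (fun j q => continuous_vecCoeff (hvx j) (hvs j) (hCa j) hsa q) hdiv
    (fun j s => eq_wienField_vecCoeff (hvx j) (hCa j) hsa s) hθ₀ hweak hV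

/-- The same through the clause bundle of `Negative.KillShape`. [folklore] -/
theorem not_anomalous_of_isCandidate_fourierDecay {g : UnitAddTorus (Fin 2) → EuclideanSpace ℝ (Fin 2)}
    (hadm : IsAdmissible g h) {ν : ℕ → ℝ}
    {v₀ : ℕ → UnitAddTorus (Fin 2) → EuclideanSpace ℝ (Fin 2)} {v : ℕ → ℝ → UnitAddTorus (Fin 2) → EuclideanSpace ℝ (Fin 2)}
    {θ₀ : ℕ → UnitAddTorus (Fin 2) → ℝ} {θ : ℕ → ℝ → UnitAddTorus (Fin 2) → ℝ}
    (hcand : IsCandidate g h ν v₀ v θ₀ θ) {σ B : ℝ} (hσ : 4 < σ) (hB : 0 ≤ B)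
    (hvx : ∀ j s, Continuous (v j s)) (hvs : ∀ j x, Continuous fun s => v j s x)
    (hdec : ∀ j s q, ‖vecCoeff (v j) s q‖ ≤ B * (1 + (qrad q : ℝ)) ^ (-σ))
    (hdiv : ∀ j s q, zdot q (vecCoeff (v j) s q) = 0)
    (hV : VarianceBounded θ) : ¬ Anomalous ν θ := by
  obtain ⟨E, hE⟩ := hV
  exact fourierDecay_not_anomalous hadm.smooth_h hadm.zeroMean_h hσ hB hcand.pos hcand.tendsto hvx hvs hdec hdiv
    hcand.memLp hcand.weak hE

end FourierDecay

end Summit.AnomalousDissipation.AnomalousDissipation.Theorems.ScalarAnomalySteadySourceFormal.Negative
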